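import Summits.BirchSwinnertonDyer.BirchSwinnertonDyer.Theorems.KatoDescentTamePotSupersingularTameLowerPdescShape
import HarnessLib

/-!
# Route `KatoDescentTamePotSupersingular` (rung K8-t′ = KT, cell `bsd-potss`), child crux `TameLowerIntrinsicNonCM`
# (item stmt-BirchSwinnertonDyer-19618), registered stub `stub_intr_residualNonCM`, REDUCIBLE disjunct — the MIRROR /
# DEEP classes (`ord_p #Ш_an = 4` at the `p`-torsion-free member): the per-class road from ONE SUBGROUP OF ORDER `p³`
# in `Ш` + the Cassels–Tate square, at ANY prime `p` (seat `bsd-potss-kt-pdesc`, ACCEL row (4) of planner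
# bsd-potss-plan g14; a `--supports stmt-BirchSwinnertonDyer-19618 --as helper` file; closes NOTHING class-wide)

PARTITION (D-0054, cell bsd-potss): EXCLUDED-DOMAIN non-CM additive `p` · B4 (t′), `r_an = 0`, INTRINSIC × {`E[p]`
reducible} — the RESIDUE of the first-descent road of `…TameLowerPdescShape.lean` (p462201): the MIRROR classes
(census of this seat, kit j257757: `169812c`, `263934k`, `434070da` at `p = 3`), shaped {`E` with a rational
`3`-torsion point `S`, `#Ш_an(E) = 9`, `Ш(E)[φ] = 0`} –φ→ {`E^ = E/⟨S⟩`, `E^[φ̂] ≅ μ₃`, `#Ш_an(E^) = 81`,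
`dim Ш(E^)[φ̂] = 2`}: the visible `Ш` sits at the `ord₃ = 4` member, where ONE element of order `p` certifies only
`p² ∣ #Ш`. The same shape is the K9 cell's «29 X3 mirror classes» and, with `E[3]` irreducible, its «11 DEEP X4
classes» (K9-DESC3-WITNESS.md §6, seat k9-c2 g2), whose logical chain was so far evidence-tier prose only.

WHAT THIS FILE DOES. The tree's `missingLowerBoundAt_of_casselsTate_of_pow_dvd` (cell b2b-bsdres: `Ш` finite,
`ord_p #Ш_an ≤ 2k`, `p^{2k−1} ∣ #Ш` ⇒ lower half, by Cassels–Tate squareness) at `k = 2` needs `p³ ∣ #Ш`; Lagrange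
(`AddSubgroup.card_dvd_of_injective`, as in the cell's `pow_dvd_shaOrder_of_injective`) turns ONE injective additive
map `G →+ Ш(W₀)` from any group of order `p³` into that divisibility. So:
* §1 `KTPdesc.missingLowerBoundAt_of_subgroupCube`: `r_an(W₀) = 0`, `#Ш_an(W₀) = s` with `ord_p s ≤ 4`, an injective
  `G →+ Ш(W₀/ℚ)` with `Nat.card G = p³` ⇒ `MissingLowerBoundAt W₀ p`; §2 its transport to every globally minimal
  member (Cassels, GZK, modularity); §3 the literal-model record shape (Kraus minimality per record, `Δ ≠ 0`).
* The EVIDENCE that fills the subgroup slot on a mirror class is the sha-2 recipe (K9-DESC3-WITNESS §6): (C1) first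
  descent, two engines, EXACT: `Ш(E)[φ] = 0` and `dim Ш(E^)[φ̂] = 2` (kit j257757 rows), hence `Ш(E^)[p] = Ш(E^)[φ̂]`
  (`φ(φ̂ x) = p x = 0 ⇒ φ̂ x ∈ Ш(E)[φ] = 0`) of dimension exactly `2`; (C2) the Cassels–Tate pairing on
  `S^(φ̂)(E^/ℚ) ⊂ ℚ^×/ℚ^{×p}` is IDENTICALLY ZERO (engine C `ctpc.gp`, van Beek–Fisher, Acta Arith. 185 (2018));
  (T) CT non-degenerate alternating on the finite `Ш(E^)` ⇒ `Ш[p] ⊆ (Ш[p])^⊥ = pШ` ⇒ `Ш(E^)[p²] ≅ (ℤ/p²)²`, which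
  contains `ℤ/p² × ℤ/p` of order `p³` (and `(ℤ/p²)²` of order `p⁴`). (C2) is NOT run by this seat at the time of
  filing (typed slot; the successor's first task); nothing is claimed for the three classes here.

HONEST LABEL: a per-class road over four PUBLISHED facts by name (Cassels–Tate, Cassels, GZK, modularity) and one
certificate slot whose evidence lives outside the kernel; BSD is not proved; the item is NOT closed; nothing is
booked. THEOREMS ONLY (no definition, no named fact, no `sorry`). Route-free imports.

References: [SilvermanAEC2009] Thm. X.4.14; [Cassels1962ArithmeticIV] ("the order of Ш, if finite, is a square");
[MilneADT2006] Thm. I.7.3; [Miller2011LMS] Def. 1.1; M. van Beek–T. Fisher, Acta Arith. 185 (2018) 367–396, Thm. 2.9/2.11;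
[Kato2004Asterisque] Conj. 12.10 (p. 224).
-/

set_option autoImplicit false
-- sibling precedent (`KatoDescentTamePotSupersingularTameLowerKimRoad.lean`): the directory name repeats the summit name
set_option linter.dupNamespace false

noncomputable section

open scoped Classical

namespace Summit.BirchSwinnertonDyer.BirchSwinnertonDyer.Theorems

open WeierstrassCurve Literature.NumberTheory.EllipticCurves
  Literature.NumberTheory.EllipticCurves.Rank1Residual
  Literature.NumberTheory.EllipticCurves.Rank1Residual.Typed
  Literature.NumberTheory.EllipticCurves.Rank1Residual.X11RankOneCertificates
  Summit.BirchSwinnertonDyer.Rank1Residual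
  Summit.BirchSwinnertonDyer.Rank1Residual.Additive

/-! ## §1 The pair road: a subgroup of order `p³` in `Ш(W₀)` + the Cassels–Tate square -/

/-- **`MissingLowerBoundAt W₀ p` at a pair with `ord_p #Ш_an ≤ 4` from ONE subgroup of order `p³` in `Ш(W₀/ℚ)`**
(class-free, any prime `p`): `W₀` of analytic rank `0` (`Ш` finite by GZK), `#Ш_an(W₀) = s` with `ord_p s ≤ 4`, and
an injective additive map `f : G →+ Ш(W₀)` from a group with `Nat.card G = p³` ⇒ `p³ ∣ #Ш` (Lagrange,
`AddSubgroup.card_dvd_of_injective`) ⇒ `p⁴ ∣ #Ш` (Cassels–Tate squareness, `missingLowerBoundAt_of_casselsTate_of_pow_dvd`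
at `k = 2`) ⇒ `ord_p #Ш_an ≤ 4 ≤ ord_p #Ш`. The `ord ≤ 2` analogue is `KTPdesc.missingLowerBoundAt_of_shaWitness`.
[cite: SilvermanAEC2009, Thm. X.4.14] [cite: Miller2011LMS, §1 and Def. 1.1] -/
theorem KTPdesc.missingLowerBoundAt_of_subgroupCube (hCT : exists_casselsTate_pairing (K := ℚ))
    (hGZK : rank_eq_analyticRank_of_analyticRank_le_one)
    (W₀ : WeierstrassCurve ℚ) [W₀.IsElliptic] (p : ℕ) [Fact p.Prime] (hr : W₀.analyticRank = 0)
    {s : ℚ} (hs : shaAn W₀ = (s : ℂ)) (hv : padicValRat p s ≤ 4)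
    {G : Type*} [AddGroup G] (hG : Nat.card G = p ^ 3) (f : G →+ W₀.sha) (hf : Function.Injective f) :
    MissingLowerBoundAt W₀ p := by
  have hdvd : p ^ 3 ∣ W₀.shaOrder := by
    rw [WeierstrassCurve.shaOrder, ← hG]
    exact AddSubgroup.card_dvd_of_injective f hf
  exact missingLowerBoundAt_of_casselsTate_of_pow_dvd W₀ p hCT (hGZK W₀ (by rw [hr]; norm_num)).2 hs
    (k := 2) (by simpa using hv) (by simpa using hdvd)

/-! ## §2 … and at every globally minimal member of the class (Cassels transport) -/

/-- **`MissingLowerBoundAt W p` at EVERY globally minimal member of the class of a member carrying a subgroup of order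
`p³` in `Ш`** (class-free, any prime `p`): §1 at `W₀` (`ord_p #Ш_an(W₀) ≤ 4`), then Cassels' transport
(`TwistComparison.missingLowerBoundAt_of_isIsogenous`, over Cassels `hCassels` + GZK + modularity `hmod`). This is the
road for a MIRROR class read at its `ord_p = 4` member. Conditional on the four published facts and the subgroup slot.
[cite: MilneADT2006, Thm. I.7.3] [cite: SilvermanAEC2009, Thm. X.4.14] [cite: Miller2011LMS, §1 and Def. 1.1] -/
theorem KTPdesc.missingLowerBoundAt_of_isIsogenous_of_subgroupCube
    (hCT : exists_casselsTate_pairing (K := ℚ)) (hCassels : bsdRHS_eq_of_isIsogenous)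
    (hGZK : rank_eq_analyticRank_of_analyticRank_le_one) (hmod : hasEntireLFunction_rat)
    (W₀ : WeierstrassCurve ℚ) [W₀.IsElliptic] [W₀.IsGloballyMinimal] (p : ℕ) [Fact p.Prime]
    (hr : W₀.analyticRank = 0) {s : ℚ} (hs : shaAn W₀ = (s : ℂ)) (hv : padicValRat p s ≤ 4)
    {G : Type*} [AddGroup G] (hG : Nat.card G = p ^ 3) (f : G →+ W₀.sha) (hf : Function.Injective f)
    (W : WeierstrassCurve ℚ) [W.IsElliptic] [W.IsGloballyMinimal] (hiso : IsIsogenous W W₀) :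
    MissingLowerBoundAt W p := by
  have hr' : W₀.analyticRank ≤ 1 := by rw [hr]; exact zero_le_one
  exact TwistComparison.missingLowerBoundAt_of_isIsogenous W₀ W p hCassels hGZK hmod hiso.symm_of_charZero hr'
    (KTPdesc.missingLowerBoundAt_of_subgroupCube hCT hGZK W₀ p hr hs hv hG f hf)

/-! ## §3 The record SHAPE on a literal model -/

/-- **RECORD SHAPE along the class, subgroup-of-order-`p³` currency — literal certificate member** (any prime `p`; for
the MIRROR / DEEP classes, read at the member `W₀ = ⟨a₁,…,a₆⟩` with `ord_p #Ш_an(W₀) = 4`): global minimality (`hmin`,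
discharged per record by the tree's Kraus criteria), `Δ ≠ 0` (`hΔ`), `r_an = 0` (`hr`), `#Ш_an(W₀) = s` with
`ord_p s ≤ 4` (`hs`, `hv`), an injective `f : G →+ Ш(W₀)` with `Nat.card G = p³` (`hG`, `hf`: the certificate slot —
EVIDENCE recipe: exact first descent `dim Ш(W₀)[p] = 2` + Cassels–Tate pairing `≡ 0` on `S^(φ̂)(W₀/ℚ)` ⇒
`Ш(W₀)[p²] ≅ (ℤ/p²)² ⊇ ℤ/p² × ℤ/p`), Cassels `hCassels`, modularity `hmod` ⇒ `MissingLowerBoundAt W p` at every globally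
minimal `W ∼_ℚ W₀`. Per class; nothing booked. [cite: MilneADT2006, Thm. I.7.3] [cite: SilvermanAEC2009, Thm. X.4.14]
[cite: Miller2011LMS, §1 and Def. 1.1] -/
theorem KTPdesc.missingLowerBoundAt_of_isIsogenous_ainvs_of_subgroupCube
    (hCT : exists_casselsTate_pairing (K := ℚ)) (hCassels : bsdRHS_eq_of_isIsogenous)
    (hGZK : rank_eq_analyticRank_of_analyticRank_le_one) (hmod : hasEntireLFunction_rat)
    (a1 a2 a3 a4 a6 : ℤ) (hmin : (⟨a1, a2, a3, a4, a6⟩ : WeierstrassCurve ℚ).IsGloballyMinimal)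
    (hΔ : discOf [a1, a2, a3, a4, a6] ≠ 0) (p : ℕ) [Fact p.Prime]
    (hr : (⟨a1, a2, a3, a4, a6⟩ : WeierstrassCurve ℚ).analyticRank = 0)
    {s : ℚ} (hs : shaAn (⟨a1, a2, a3, a4, a6⟩ : WeierstrassCurve ℚ) = (s : ℂ)) (hv : padicValRat p s ≤ 4)
    {G : Type*} [AddGroup G] (hG : Nat.card G = p ^ 3)
    (f : G →+ (⟨a1, a2, a3, a4, a6⟩ : WeierstrassCurve ℚ).sha) (hf : Function.Injective f)
    (W : WeierstrassCurve ℚ) [W.IsElliptic] [W.IsGloballyMinimal]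
    (hiso : IsIsogenous W (⟨a1, a2, a3, a4, a6⟩ : WeierstrassCurve ℚ)) : MissingLowerBoundAt W p := by
  haveI := X11b.isElliptic_of_discOf_ne_zero a1 a2 a3 a4 a6 hΔ
  haveI := hmin
  exact KTPdesc.missingLowerBoundAt_of_isIsogenous_of_subgroupCube hCT hCassels hGZK hmod _ p hr hs hv hG f hf W hiso

/-! ## §4 The registered stub's REDUCIBLE disjunct from ONE certificate per class — three currencies -/

/-- **The reducible disjunct of `Sig.stub_intr_residualNonCM` (birth skeleton v4 of 19618; row binders VERBATIM, `Intrinsic`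
inlined, restricted by `¬ Irr W p`) from the four published facts and ONE CERTIFICATE PER CLASS in any of THREE currencies**
— the completed form of `KTPdesc.stub_intr_residualNonCM_reducible_of_certificates` (p462201, two currencies): `hwit` gives, in
the class of every intrinsic non-CM (t′) rank-`0` row with `E[p]` reducible, a globally minimal member `W₀` of analytic rank `0`
with `#Ш_an(W₀) = s` and EITHER (`ord_p s ≤ 2`, `p ∤ #W₀(ℚ)_tors`, `Sel^(p)(W₀/ℚ) ≠ ⊥`) OR (`ord_p s ≤ 2` and a nonzero `x ∈ Ш(W₀)`
with `p·x = 0`) OR (`ord_p s ≤ 4` and an injective `ℤ/p² × ℤ/p →+ Ш(W₀)` — the MIRROR/DEEP currency of §1). On the census of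
this seat (b2b O5, `N < 5·10⁵`) the three currencies cover ALL 30 intrinsic reducible (t′) classes (records parts 01–05:
14 + 3 Sel, 10 witness, 3 subgroup). HONEST LABEL: a per-class road made uniform by hypothesis — class-wide `hwit` is the stub's
own content on the reducible rows (Kato 12.10 lower half, open); conditional; the item is NOT closed.
[cite: Kato2004Asterisque, Conj. 12.10 (p. 224)] [cite: SilvermanAEC2009, Thm. X.4.14] [cite: MilneADT2006, Thm. I.7.3]
[cite: Miller2011LMS, §1 and Def. 1.1] -/
theorem KTPdesc.stub_intr_residualNonCM_reducible_of_certificates3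
    (hCT : exists_casselsTate_pairing (K := ℚ)) (hCassels : bsdRHS_eq_of_isIsogenous)
    (hGZK : rank_eq_analyticRank_of_analyticRank_le_one) (hmod : hasEntireLFunction_rat)
    (hwit : ∀ (W : WeierstrassCurve ℚ) [W.IsElliptic] [W.IsGloballyMinimal] (p : ℕ) [Fact p.Prime],
      W.analyticRank = 0 → p ≠ 2 → Addv W p → SubTprime W p → ¬ Irr W p → ¬ W.HasCM →
      (∀ (W' : WeierstrassCurve ℚ) [W'.IsElliptic] [W'.IsGloballyMinimal], IsIsogenous W W' →
        ∀ q' : ℚ, shaAn W' = (q' : ℂ) → 0 < padicValRat p q') →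
      ∃ (W₀ : WeierstrassCurve ℚ) (_ : W₀.IsElliptic) (_ : W₀.IsGloballyMinimal),
        IsIsogenous W W₀ ∧ W₀.analyticRank = 0 ∧
        ∃ s : ℚ, shaAn W₀ = (s : ℂ) ∧
          ((padicValRat p s ≤ 2 ∧ ¬ p ∣ W₀.torsionOrder ∧ W₀.selmerGroup (p : ℤ) ≠ ⊥) ∨
           (padicValRat p s ≤ 2 ∧ ∃ x : W₀.sha, x ≠ 0 ∧ p • x = 0) ∨
           (padicValRat p s ≤ 4 ∧ ∃ f : (ZMod (p ^ 2) × ZMod p) →+ W₀.sha, Function.Injective f))) :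
    ∀ (W : WeierstrassCurve ℚ) [W.IsElliptic] [W.IsGloballyMinimal] (p : ℕ) [Fact p.Prime],
      W.analyticRank = 0 → p ≠ 2 → Addv W p → SubTprime W p → ¬ Irr W p → ¬ W.HasCM →
      (∀ (W' : WeierstrassCurve ℚ) [W'.IsElliptic] [W'.IsGloballyMinimal], IsIsogenous W W' →
        ∀ q' : ℚ, shaAn W' = (q' : ℂ) → 0 < padicValRat p q') →
      MissingLowerBoundAt W p := by
  intro W _ _ p _ hr hp2 hadd hT hred hCM hI
  obtain ⟨W₀, hE₀, hM₀, hiso, hr₀, s, hs, hcert⟩ := hwit W p hr hp2 hadd hT hred hCM hI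
  haveI := hE₀
  haveI := hM₀
  rcases hcert with ⟨hv, htors, hSel⟩ | ⟨hv, hx⟩ | ⟨hv, f, hf⟩
  · exact KTPdesc.missingLowerBoundAt_of_isIsogenous_of_selmerGroup_ne_bot hCT hCassels hGZK hmod W₀ p hr₀ htors
      hs hv hSel W hiso
  · exact KTPdesc.missingLowerBoundAt_of_isIsogenous_of_shaWitness hCT hCassels hGZK hmod W₀ p hr₀ hs hv hx W hiso
  · have hG : Nat.card (ZMod (p ^ 2) × ZMod p) = p ^ 3 := by
      rw [Nat.card_prod, Nat.card_zmod, Nat.card_zmod]; ring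
    exact KTPdesc.missingLowerBoundAt_of_isIsogenous_of_subgroupCube hCT hCassels hGZK hmod W₀ p hr₀ hs hv hG f hf
      W hiso

end Summit.BirchSwinnertonDyer.BirchSwinnertonDyer.Theorems

end
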